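import Summits.Parity.BatemanHorn.Theorems.RoughParitySectorsOddSectorShareLinearSieveDecouplingOddAux4
import Literature.NumberTheory.Sieve.RoughOmegaCells
import HarnessLib

/-!
# Route `RoughParitySectors`, crux `OddSectorShareLinear` (stmt-Parity-15629), line `birth`:
# helpers V for the stub `stub_sieveDecouplingOdd_of_roughCellsBV` — the remainder bound at a fixed height

`--supports stmt-Parity-15629`.  Packaging of `…SieveDecouplingOddAux4` for the assembly of the stub
S'b: at a fixed height, from the rough-cell Bombieri–Vinogradov hypothesis at `X = y`, `Y = z'`
(one reduced class per modulus, every cell `Ω = j + 1`, saving `(log y)^{2(2S+3) + 2S²}`) to a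
majorant `E ≥ 0` of all the odd class discrepancies modulo every `q ≥ 1` with the divisor-weighted
level bound `∑_{q ≤ y^{1/4}} S^{ω(q)} E(q) ≤ C₂ y/(log y)^{2S+3}` (`exists_level_majorant`): the
rough numbers `≤ y` have `Ω ≤ J` once `log y ≤ J log z'` (`cardFactors_le_of_mem_roughIcc_ceil`),
the majorant of `exists_majorant`, and Cauchy–Schwarz (`sum_pow_omega_mul_le`).
-/

noncomputable section

open Finset
open scoped BigOperators ArithmeticFunction.Omega ArithmeticFunction.omega
open Literature.NumberTheory.Sieve

namespace Summit.Parity.BatemanHorn.Cruxes.OddSectorShareLinear.Birth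

namespace SieveDecouplingOdd

/-- **`Ω ≤ J` on the rough numbers**: if `z' > 1` and `log y ≤ J log z'` then every
`b ∈ roughIcc ⌈z'⌉ y` has `Ω(b) ≤ J` (`z'^{Ω(b)} ≤ ⌈z'⌉^{Ω(b)} ≤ b ≤ y`). [folklore] -/
theorem cardFactors_le_of_mem_roughIcc_ceil {z' : ℝ} {y J b : ℕ} (hz1 : 1 < z')
    (hlog : Real.log y ≤ J * Real.log z') (hb : b ∈ roughIcc ⌈z'⌉₊ y) : Ω b ≤ J := by
  by_contra hlt
  push Not at hlt
  have hz0 : 0 < z' := by linarith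
  have hb' := mem_roughIcc.mp hb
  have hb1 : (1 : ℝ) ≤ b := by exact_mod_cast hb'.1.1
  have hpow := pow_cardFactors_le_of_mem_roughIcc hb
  have h1 : z' ^ (J + 1) ≤ (y : ℝ) :=
    calc z' ^ (J + 1) ≤ z' ^ Ω b := pow_le_pow_right₀ hz1.le hlt
      _ ≤ (⌈z'⌉₊ : ℝ) ^ Ω b := pow_le_pow_left₀ hz0.le (Nat.le_ceil z') _
      _ ≤ (b : ℝ) := by exact_mod_cast hpow
      _ ≤ (y : ℝ) := by exact_mod_cast hb'.1.2
  have h2 : Real.log (z' ^ (J + 1)) ≤ Real.log y := Real.log_le_log (pow_pos hz0 _) h1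
  rw [Real.log_pow, Nat.cast_add, Nat.cast_one] at h2
  have hlogz : 0 < Real.log z' := Real.log_pos hz1
  nlinarith

/-- `√(4Jy e (JCy)) = √(4J²C e) · y` for `y ≥ 0`. [folklore] -/
theorem sqrt_level_const {J y C e : ℝ} (hy : 0 ≤ y) :
    Real.sqrt (4 * J * y * e * (J * C * y)) = Real.sqrt (4 * J * J * C * e) * y := by
  rw [show 4 * J * y * e * (J * C * y) = (4 * J * J * C * e) * y ^ 2 by ring, Real.sqrt_mul',
    Real.sqrt_sq hy]
  positivity

/-- **The remainder bound at a fixed height.**  From the rough-cell Bombieri–Vinogradov hypothesis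
at `X = y ≥ 3`, `Y = z' > 1` with `log y ≤ J log z'`, for every cell and one reduced class per
modulus, with the saving `(log y)^{2(2S+3) + 2S²}`: there is a majorant `E ≥ 0` of the odd class
discrepancies of `roughIcc ⌈z'⌉ y` modulo every `q ≥ 1` with
`∑_{q ≤ y^{1/4}} S^{ω(q)} E(q) ≤ √(4J²C e^{10S²}) y/(log y)^{2S+3}`. [folklore] -/
theorem exists_level_majorant {z' C : ℝ} {y J S : ℕ} (hC : 0 ≤ C) (hz1 : 1 < z')
    (hy3 : 3 ≤ (y : ℝ)) (hlog : Real.log y ≤ J * Real.log z')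
    (hBV : ∀ (j : ℕ) (c : ℕ → ℕ), (∀ q : ℕ, 0 < q → (c q).Coprime q) →
      ∑ q ∈ Icc 1 ⌊(y : ℝ) ^ ((1 : ℝ) / 4)⌋₊,
        |(#((roughIcc ⌈z'⌉₊ y).filter (fun b : ℕ => Ω b = j + 1 ∧ b ≡ c q [MOD q])) : ℝ) -
          (#((roughIcc ⌈z'⌉₊ y).filter (fun b : ℕ => Ω b = j + 1 ∧ b.Coprime q)) : ℝ) /
            Nat.totient q| ≤
        C * y / Real.log y ^ (2 * ((2 * S + 3 : ℕ) : ℝ) + 2 * (S : ℝ) ^ 2)) :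
    ∃ E : ℕ → ℝ, (∀ q, 0 ≤ E q) ∧
      (∀ q a : ℕ, 0 < q → a.Coprime q →
        |(#((roughIcc ⌈z'⌉₊ y).filter (fun b : ℕ => Odd (Ω b) ∧ b ≡ a [MOD q])) : ℝ) -
          (#((roughIcc ⌈z'⌉₊ y).filter (fun b : ℕ => Odd (Ω b) ∧ b.Coprime q)) : ℝ) /
            Nat.totient q| ≤ E q) ∧
      ∑ q ∈ Icc 1 ⌊(y : ℝ) ^ ((1 : ℝ) / 4)⌋₊, (S : ℝ) ^ ω q * E q ≤
        Real.sqrt (4 * J * J * C * Real.exp (2 * (S : ℝ) ^ 2 * 5)) * y / Real.log y ^ (2 * S + 3) := by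
  have hy1 : (1 : ℝ) ≤ y := by linarith
  have hy0 : (0 : ℝ) ≤ y := by linarith
  have hy1' : 1 ≤ y := by exact_mod_cast hy1
  set Q : ℕ := ⌊(y : ℝ) ^ ((1 : ℝ) / 4)⌋₊ with hQ
  have hQy' : (Q : ℝ) ≤ y := by
    calc (Q : ℝ) ≤ (y : ℝ) ^ ((1 : ℝ) / 4) := Nat.floor_le (by positivity)
      _ ≤ (y : ℝ) ^ (1 : ℝ) := Real.rpow_le_rpow_of_exponent_le hy1 (by norm_num)
      _ = y := Real.rpow_one _
  have hQy : Q ≤ y := by exact_mod_cast hQy'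
  have hJ : ∀ b ∈ roughIcc ⌈z'⌉₊ y, Ω b ≤ J := fun b hb =>
    cardFactors_le_of_mem_roughIcc_ceil hz1 hlog hb
  obtain ⟨E, hE0, hEmaj, hEtriv, hEsum⟩ := exists_majorant (J := J) hC hy1' hQy hBV
  refine ⟨E, hE0, fun q a hq ha => hEmaj q a hq ha hJ, ?_⟩
  have hS0 : (0 : ℝ) ≤ S := Nat.cast_nonneg _
  have hM0 : (0 : ℝ) ≤ 4 * J * y := by positivity
  have hB0 : (0 : ℝ) ≤ J * C * y := by positivity
  have hB : ∑ q ∈ Icc 1 Q, E q ≤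
      J * C * y / Real.log y ^ (2 * ((2 * S + 3 : ℕ) : ℝ) + 2 * (S : ℝ) ^ 2) :=
    hEsum.trans (le_of_eq (by ring))
  have hCS := sum_pow_omega_mul_le (K := (S : ℝ)) (n := 2 * S + 3) hS0 hy3 hQy' hE0 hM0 hB0 hEtriv hB
  rw [sqrt_level_const hy0] at hCS
  exact hCS.trans (le_of_eq (by ring))

end SieveDecouplingOdd

/-- **Sub-goal (the remainder bound at a fixed height)** of the stub
`stub_sieveDecouplingOdd_of_roughCellsBV` (crux stmt-Parity-15629, line `birth`): the statement of
`SieveDecouplingOdd.exists_level_majorant` written out. [folklore] -/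
theorem stub_decouplingOddLevelMajorant :
    ∀ (z' C : ℝ) (y J S : ℕ), 0 ≤ C → 1 < z' → 3 ≤ (y : ℝ) → Real.log y ≤ J * Real.log z' → (∀ (j :
    ℕ) (c : ℕ → ℕ), (∀ q : ℕ, 0 < q → (c q).Coprime q) → ∑ q ∈ Finset.Icc 1 ⌊(y : ℝ) ^ ((1 : ℝ) /
    4)⌋₊, |((((Literature.NumberTheory.Sieve.roughIcc ⌈z'⌉₊ y).filter (fun b : ℕ =>
    ArithmeticFunction.cardFactors b = j + 1 ∧ Nat.ModEq q b (c q))).card : ℕ) : ℝ) -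
    ((((Literature.NumberTheory.Sieve.roughIcc ⌈z'⌉₊ y).filter (fun b : ℕ =>
    ArithmeticFunction.cardFactors b = j + 1 ∧ b.Coprime q)).card : ℕ) : ℝ) / ((Nat.totient q : ℕ) :
    ℝ)| ≤ C * y / Real.log y ^ (2 * ((2 * S + 3 : ℕ) : ℝ) + 2 * (S : ℝ) ^ 2)) → ∃ E : ℕ → ℝ, (∀ q, 0
    ≤ E q) ∧ (∀ q a : ℕ, 0 < q → a.Coprime q → |((((Literature.NumberTheory.Sieve.roughIcc ⌈z'⌉₊
    y).filter (fun b : ℕ => Odd (ArithmeticFunction.cardFactors b) ∧ Nat.ModEq q b a)).card : ℕ) :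
    ℝ) - ((((Literature.NumberTheory.Sieve.roughIcc ⌈z'⌉₊ y).filter (fun b : ℕ => Odd
    (ArithmeticFunction.cardFactors b) ∧ b.Coprime q)).card : ℕ) : ℝ) / ((Nat.totient q : ℕ) : ℝ)| ≤
    E q) ∧ ∑ q ∈ Finset.Icc 1 ⌊(y : ℝ) ^ ((1 : ℝ) / 4)⌋₊, (S : ℝ) ^
    (ArithmeticFunction.cardDistinctFactors q) * E q ≤ Real.sqrt (4 * J * J * C * Real.exp (2 * (S :
    ℝ) ^ 2 * 5)) * y / Real.log y ^ (2 * S + 3)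
 :=
  fun _ _ _ _ _ hC hz1 hy3 hlog hBV => SieveDecouplingOdd.exists_level_majorant hC hz1 hy3 hlog hBV

end Summit.Parity.BatemanHorn.Cruxes.OddSectorShareLinear.Birth

end
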